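import Mathlib

/-!
# A1IdempotentDecomposition — a module over a commutative ring with a complete family of orthogonal
idempotents is the internal direct sum of the pieces `e i • M`

route/T4-A1-p7.md (A0.4) decomposes `H¹(A, ℂ) = ⊕_σ ℓ_σ` into the eigenlines of the CM field `F`: after
`ℂ ⊗[ℚ] F ≃ₐ[ℂ] ((F →ₐ[ℚ] ℂ) → ℂ)` (A1TensorSplitting.lean, p392690) the complexified cohomology is a
module over the product ring `∏_σ ℂ`, and the eigenlines are the pieces cut out by the idempotents
`e_σ = Pi.single σ 1`.  This file supplies the module-theoretic half in general:

* `piece e i` — the submodule `e i • M` of an `R`-module `M`, for `e : ι → R`.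
* `isInternal_piece` — for `CompleteOrthogonalIdempotents e` (`Finite ι`), `DirectSum.IsInternal (piece e)`:
  `M = ⊕_i e i • M`, with the explicit inverse `toPieces m = ∑ i, e i • m`.
* `mem_piece_iff_forall_smul_eq` — for the product ring `R = ι → K`, the piece of `Pi.single i 1` is the
  `i`-th EIGENSPACE `{m | ∀ a, a • m = a i • m}` (the scalars act through their `i`-th coordinate), and
  `isInternal_eigenspace` restates the decomposition for that case.

Nothing about cohomology, abelian varieties or CM types is asserted.
-/

namespace Summit.Ventures.HodgeRepro2.A1IdempotentDecomposition

open DirectSum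

section General

variable {R : Type*} [CommRing R] {ι : Type*}
variable {M : Type*} [AddCommGroup M] [Module R M]

/-- The piece `e i • M` of `M` cut out by the `i`-th element of a family `e : ι → R`. -/
def piece (e : ι → R) (i : ι) : Submodule R M :=
  LinearMap.range (LinearMap.lsmul R M (e i))

/-- Membership in `piece e i`: `m = e i • x` for some `x`. -/
theorem mem_piece_iff (e : ι → R) (i : ι) (m : M) : m ∈ piece e i ↔ ∃ x, e i • x = m := by
  simp [piece, LinearMap.mem_range]

/-- `e i • m` lies in the `i`-th piece. -/
theorem smul_mem_piece (e : ι → R) (i : ι) (m : M) : e i • m ∈ piece e i :=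
  (mem_piece_iff e i _).2 ⟨m, rfl⟩

variable {e : ι → R}

/-- For idempotent `e i`, the `i`-th piece is the fixed set of `e i •`. -/
theorem mem_piece_iff_smul_eq (he : ∀ i, IsIdempotentElem (e i)) (i : ι) (m : M) :
    m ∈ piece e i ↔ e i • m = m := by
  rw [mem_piece_iff]
  constructor
  · rintro ⟨x, rfl⟩
    rw [smul_smul, (he i).eq]
  · intro h
    exact ⟨m, h⟩

variable [DecidableEq ι]

/-- The idempotents act on the pieces as projections: `e i • m = m` for `m` in the `i`-th piece and
`e i • m = 0` for `m` in another piece. -/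
theorem smul_of_mem_piece (he : OrthogonalIdempotents e) (i j : ι) {m : M}
    (hm : m ∈ piece e j) : e i • m = if i = j then m else 0 := by
  obtain ⟨x, rfl⟩ := (mem_piece_iff e j m).1 hm
  rw [smul_smul, he.mul_eq]
  split_ifs with h
  · subst h; rfl
  · rw [zero_smul]

/-- `coeAddMonoidHom` and `coeLinearMap` are the same function on `⨁ i, piece e i`. -/
theorem coeAddMonoidHom_piece_eq :
    ⇑(DirectSum.coeAddMonoidHom (piece (M := M) e)) = ⇑(DirectSum.coeLinearMap (piece (M := M) e)) := by
  have h : DirectSum.coeAddMonoidHom (piece (M := M) e) =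
      (DirectSum.coeLinearMap (piece (M := M) e)).toAddMonoidHom :=
    DirectSum.addHom_ext fun i y => by
      rw [DirectSum.coeAddMonoidHom_of, LinearMap.toAddMonoidHom_coe, DirectSum.coeLinearMap_of]
  rw [h]
  rfl

variable [Fintype ι]

/-- The decomposition map `m ↦ (e i • m)_i` into the direct sum of the pieces. -/
noncomputable def toPieces (e : ι → R) : M →ₗ[R] ⨁ i, piece (M := M) e i :=
  ∑ i, (DirectSum.lof R ι (fun i => piece (M := M) e i) i).comp
    (LinearMap.codRestrict (piece e i) (LinearMap.lsmul R M (e i)) (smul_mem_piece e i))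

/-- `toPieces` followed by the sum of the components is the identity (the family is complete). -/
theorem coeLinearMap_toPieces (he : CompleteOrthogonalIdempotents e) (m : M) :
    DirectSum.coeLinearMap (piece (M := M) e) (toPieces e m) = m := by
  rw [toPieces, LinearMap.sum_apply, map_sum]
  simp only [LinearMap.comp_apply, DirectSum.coeLinearMap_lof, LinearMap.codRestrict_apply,
    LinearMap.lsmul_apply]
  rw [← Finset.sum_smul, he.complete, one_smul]

/-- The sum of the components followed by `toPieces` is the identity (orthogonality). -/
theorem toPieces_coeLinearMap (he : CompleteOrthogonalIdempotents e)
    (x : ⨁ i, piece (M := M) e i) :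
    toPieces e (DirectSum.coeLinearMap (piece (M := M) e) x) = x := by
  suffices h : (toPieces e).comp (DirectSum.coeLinearMap (piece (M := M) e)) = LinearMap.id from
    LinearMap.congr_fun h x
  refine DirectSum.linearMap_ext _ fun j => LinearMap.ext fun y => ?_
  simp only [LinearMap.comp_apply, DirectSum.coeLinearMap_lof, LinearMap.id_apply]
  rw [toPieces, LinearMap.sum_apply, Finset.sum_eq_single j]
  · simp only [LinearMap.comp_apply]
    congr 1
    apply Subtype.ext
    simp only [LinearMap.codRestrict_apply, LinearMap.lsmul_apply]
    rw [smul_of_mem_piece he.toOrthogonalIdempotents j j y.2, if_pos rfl]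
  · intro i _ hij
    simp only [LinearMap.comp_apply]
    have h0 : LinearMap.codRestrict (piece e i) (LinearMap.lsmul R M (e i))
        (smul_mem_piece e i) (y : M) = 0 := by
      apply Subtype.ext
      simp only [LinearMap.codRestrict_apply, LinearMap.lsmul_apply, Submodule.coe_zero]
      rw [smul_of_mem_piece he.toOrthogonalIdempotents i j y.2, if_neg hij]
    rw [h0, map_zero]
  · intro h
    exact absurd (Finset.mem_univ j) h

/-- The canonical map `⨁ i, e i • M → M` is bijective: `M` is the internal direct sum of the pieces. -/
theorem bijective_coeLinearMap_piece (he : CompleteOrthogonalIdempotents e) :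
    Function.Bijective (DirectSum.coeLinearMap (piece (M := M) e)) :=
  Function.bijective_iff_has_inverse.2
    ⟨toPieces e, toPieces_coeLinearMap he, coeLinearMap_toPieces he⟩

/-- **A module over a commutative ring with a complete family of orthogonal idempotents is the internal
direct sum of the pieces `e i • M`.** -/
theorem isInternal_piece (he : CompleteOrthogonalIdempotents e) :
    DirectSum.IsInternal (piece (M := M) e) := by
  unfold DirectSum.IsInternal
  rw [coeAddMonoidHom_piece_eq]
  exact bijective_coeLinearMap_piece he

end General

section Product

variable {K : Type*} [CommRing K] {ι : Type*} [Fintype ι] [DecidableEq ι]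
variable {M : Type*} [AddCommGroup M] [Module (ι → K) M]

/-- The family of coordinate idempotents `Pi.single i 1` of the product ring `ι → K`. -/
def coordIdem (K : Type*) [CommRing K] (ι : Type*) [DecidableEq ι] : ι → (ι → K) :=
  fun i => Pi.single i 1

/-- The coordinate idempotents are complete and orthogonal. -/
theorem completeOrthogonalIdempotents_coordIdem :
    CompleteOrthogonalIdempotents (coordIdem K ι) :=
  CompleteOrthogonalIdempotents.single (fun _ : ι => K)

/-- `a = ∑ j, a j • Pi.single j 1` in the product ring. -/
theorem eq_sum_smul_coordIdem (a : ι → K) :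
    a = ∑ j, (fun _ => a j) * coordIdem K ι j := by
  ext k
  simp only [Finset.sum_apply, Pi.mul_apply, coordIdem]
  rw [Finset.sum_eq_single k]
  · simp
  · intro j _ hjk
    simp [Ne.symm hjk]
  · intro h
    exact absurd (Finset.mem_univ k) h

/-- The piece of the `i`-th coordinate idempotent is the `i`-th eigenspace: the scalars `a : ι → K` act
on it through their `i`-th coordinate (as the constant function `fun _ => a i`). -/
theorem mem_piece_iff_forall_smul_eq (i : ι) (m : M) :
    m ∈ piece (coordIdem K ι) i ↔ ∀ a : ι → K, a • m = (fun _ : ι => a i) • m := by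
  constructor
  · intro hm a
    have hfix : coordIdem K ι i • m = m :=
      (mem_piece_iff_smul_eq completeOrthogonalIdempotents_coordIdem.idem i m).1 hm
    have hcoord : a * coordIdem K ι i = (fun _ : ι => a i) * coordIdem K ι i := by
      ext k
      simp only [Pi.mul_apply, coordIdem, Pi.single_apply]
      split_ifs with h
      · subst h; rfl
      · simp
    calc a • m = a • (coordIdem K ι i • m) := by rw [hfix]
      _ = (a * coordIdem K ι i) • m := by rw [smul_smul]
      _ = ((fun _ : ι => a i) * coordIdem K ι i) • m := by rw [hcoord]
      _ = (fun _ : ι => a i) • (coordIdem K ι i • m) := by rw [smul_smul]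
      _ = (fun _ : ι => a i) • m := by rw [hfix]
  · intro h
    rw [mem_piece_iff_smul_eq completeOrthogonalIdempotents_coordIdem.idem]
    have := h (coordIdem K ι i)
    rw [this]
    have h1 : (fun _ : ι => coordIdem K ι i i) = (1 : ι → K) := by
      funext k
      simp [coordIdem]
    rw [h1, one_smul]

/-- (A0.4), module half: a module over the product ring `ι → K` is the internal direct sum of its
coordinate eigenspaces. -/
theorem isInternal_eigenspace :
    DirectSum.IsInternal (piece (M := M) (coordIdem K ι)) :=
  isInternal_piece completeOrthogonalIdempotents_coordIdem

end Product

end Summit.Ventures.HodgeRepro2.A1IdempotentDecomposition
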